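import Mathlib
import Summits.MatrixMultiplication.Statement
import Summits.MatrixMultiplication.MatrixMultiplication.Theorems.GraphEquationsPivotDesigns

/-!
# The kernel of a pivot design is EXACTLY the span of its pivot fields (`GraphEquations`, M56)

Decomp-mm node «GraphEquations» (lens 5, g42); attacked leaf `MultiplicityReduction`
(stmt-MatrixMultiplication-27806).  Target VERBATIM: `_root_.MatrixMultiplication`.  Route-neutral.
Finite-range EXACT INVARIANTS of the pivot designs of M54 (`PivotDesign`), at EVERY base point `(A,B)`:

* `eq_sum_of_isKer`, `kerSpace_eq_span` — the kernel of the `C`-Jacobian is EXACTLY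
  `span {Λ_q(A) : q ∈ P}` (the pivot-test conditions on a kernel vector cancel identically);
* `finrank_kerSpace_eq_card` — **corank `= |P|` identically on the graph** (no jump locus);
* `card_quadSupport`, `finrank_kerSpace_eq_card_quadSupport` — the design has exactly `|P|` tests with a
  quadratic part, so M50's inequality `dim K(A,B) ≤ #quadSupport`
  (`AffSystem.Correct.finrank_kerSpace_le`) is ATTAINED by every design at every point; with
  `m = n²` tests the count `n² ≤ m` of M48 is attained too: designs are extremal for both;
* `reducedAt_unmask`, `unmask_correct` — appending the `|P|` generators `f_q`, `q ∈ P`, gives a correct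
  cubic system REDUCED EVERYWHERE; and `AffSystem.finrank_kerSpace_le_length_of_reducedAt` (general:
  `k` appended generators lower the corank by `≤ k`) makes `|P|` the EXACT generator-unmasking number of a
  design at every point (`card_piv_le_length_of_unmask`).
With M55 (`|P| ≥ n^{3/2}/4`): unmasking a design by generators one at a time costs `≥ n^{5/2}/4`
products — corank-COUNTING cannot feed `CubicUnmask` (NODE-g42 §3: only BATCH structure can).
Sources: [BurgisserClausenShokrollahi1997, Problem 16.3]; the cell's M48/M50/M52/M54.  No `sorry`.
-/

-- dupNamespace: forced by the nested Summit.MatrixMultiplication.MatrixMultiplication layout (D-0017)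
set_option linter.dupNamespace false

noncomputable section

namespace Summit.MatrixMultiplication.MatrixMultiplication.Theorems.GraphEquations

open Matrix Module

variable {n : ℕ}

/-! ## General: `k` appended generators lower the corank by at most `k` -/

/-- If `S` with the generators at `qs` appended is reduced at `(A,B)`, then `dim K_S(A,B) ≤ |qs|`
(restriction of kernel vectors to the coordinates `qs` is injective). -/
theorem AffSystem.finrank_kerSpace_le_length_of_reducedAt {S : AffSystem n}
    {qs : List (Fin n × Fin n)} {A B : Vec n} (h : (S.appendCoord qs).ReducedAt A B) :
    finrank ℂ (S.kerSpace A B) ≤ qs.length := by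
  let φ : S.kerSpace A B →ₗ[ℂ] (Fin qs.length → ℂ) :=
    { toFun := fun δ i => δ.1 (qs.get i)
      map_add' := fun x y => rfl
      map_smul' := fun c x => rfl }
  have hφ : Function.Injective φ := by
    rw [← LinearMap.ker_eq_bot, LinearMap.ker_eq_bot']
    intro δ hδ
    have hq : ∀ q ∈ qs, δ.1 q = 0 := fun q hq => by
      obtain ⟨i, rfl⟩ := List.get_of_mem hq
      exact congr_fun hδ i
    exact Subtype.ext (h δ.1 (AffSystem.isKer_appendCoord_iff.mpr ⟨δ.2, hq⟩))
  simpa using LinearMap.finrank_le_finrank_of_injective hφ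

namespace PivotDesign

variable (D : PivotDesign n)

/-- The finset of pivots. -/
def pivots : Finset (Fin n × Fin n) := Finset.univ.filter fun q => D.piv q = true

/-- Membership in the pivot finset. -/
theorem mem_pivots {q : Fin n × Fin n} : q ∈ D.pivots ↔ D.piv q = true := by
  simp [pivots]

/-- `|pivots| = |P|`. -/
theorem card_pivots : D.pivots.card = Fintype.card {q // D.piv q = true} :=
  (Fintype.card_subtype _).symm

/-! ## The kernel is exactly the span of the pivot fields -/

/-- **Every kernel vector is the combination `Σ_{q ∈ P} δ_q · Λ_q(A)` of the pivot fields.** -/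
theorem eq_sum_of_isKer {A B δ : Vec n} (h : D.system.IsKer A B δ) :
    δ = ∑ q ∈ D.pivots, δ q • D.kerVec A q := by
  funext p
  simp only [Finset.sum_apply, Pi.smul_apply, smul_eq_mul]
  by_cases h1 : D.piv p = true
  · -- at a pivot: only `Λ_p` contributes
    rw [Finset.sum_eq_single_of_mem p (D.mem_pivots.mpr h1)]
    · rw [kerVec_self, mul_one]
    · intro q hq hqp
      rw [D.kerVec_of_piv (D.mem_pivots.mp hq) h1, if_neg (Ne.symm hqp), mul_zero]
  · have hker : ∀ q ∈ D.pivots,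
        δ q * D.kerVec A q p = if D.srow q = p.1 then A (q.1, p.2) * δ q else 0 := by
      intro q hq
      have hpq : p ≠ q := fun h => h1 (h ▸ D.mem_pivots.mp hq)
      by_cases h3 : p.1 = D.srow q
      · rw [D.kerVec_row h3 (D.mem_pivots.mp hq), if_pos h3.symm, mul_comm]
      · rw [D.kerVec_other hpq h3, if_neg (fun h => h3 h.symm), mul_zero]
    rw [Finset.sum_congr rfl hker, ← Finset.sum_filter]
    have hfilter : D.pivots.filter (fun q => D.srow q = p.1) = D.grp p.1 := by
      ext q
      simp [pivots, grp]
    rw [hfilter]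
    have hp := h (flat n p)
    rw [system_test, test, if_neg h1] at hp
    by_cases h2 : D.slot p.1 = true
    · -- on a slot row: the slot test expresses `δ_p` through the group
      rw [if_pos h2, slotTestD_jac, sub_dotProduct, single_dotProduct, one_mul, grpVec_dotProduct,
        sub_eq_zero] at hp
      exact hp
    · -- at a coordinate: `δ_p = 0`, and no pivot is served by the row `p.1`
      rw [if_neg h2, AffSystem.coordTest_jac_dotProduct] at hp
      rw [hp]
      symm
      refine Finset.sum_eq_zero fun q hq => ?_
      exact absurd (D.slot_srow q (D.mem_grp.mp hq).1) (by rw [(D.mem_grp.mp hq).2]; exact h2)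

/-- Kernel vectors are exactly the combinations of the pivot fields. -/
theorem isKer_iff_eq_sum {A B δ : Vec n} :
    D.system.IsKer A B δ ↔ δ = ∑ q ∈ D.pivots, δ q • D.kerVec A q := by
  refine ⟨D.eq_sum_of_isKer, fun h => ?_⟩
  rw [h]
  have hmem : (∑ q ∈ D.pivots, δ q • D.kerVec A q) ∈ D.system.kerSpace A B :=
    Submodule.sum_mem _ fun q hq =>
      Submodule.smul_mem _ _ (AffSystem.mem_kerSpace.mpr (D.system_isKer (D.mem_pivots.mp hq) A B))
  exact AffSystem.mem_kerSpace.mp hmem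

/-- **`K(A,B) = span {Λ_q(A) : q ∈ P}`** at every base point. -/
theorem kerSpace_eq_span (A B : Vec n) :
    D.system.kerSpace A B =
      Submodule.span ℂ (Set.range fun q : {q // D.piv q = true} => D.kerVec A q.1) := by
  refine le_antisymm (fun δ hδ => ?_) (Submodule.span_le.mpr ?_)
  · rw [D.eq_sum_of_isKer (AffSystem.mem_kerSpace.mp hδ)]
    refine Submodule.sum_mem _ fun q hq => Submodule.smul_mem _ _ (Submodule.subset_span ?_)
    exact ⟨⟨q, D.mem_pivots.mp hq⟩, rfl⟩
  · rintro _ ⟨q, rfl⟩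
    exact AffSystem.mem_kerSpace.mpr (D.system_isKer q.2 A B)

/-- **Corank `= |P|` identically on the graph.** -/
theorem finrank_kerSpace_eq_card (A B : Vec n) :
    finrank ℂ (D.system.kerSpace A B) = Fintype.card {q // D.piv q = true} := by
  rw [kerSpace_eq_span]
  exact finrank_span_eq_card (D.kerVec_linearIndependent A)

/-! ## Designs attain M50: exactly `|P|` tests carry a quadratic part -/

/-- The quadratic part of the test at `q` is non-zero iff `q` is a pivot. -/
theorem test_M_ne_zero_iff (q : Fin n × Fin n) : (D.test q).M ≠ 0 ↔ D.piv q = true := by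
  rw [test]
  by_cases h1 : D.piv q = true
  · rw [if_pos h1]
    simp only [h1, iff_true]
    intro h
    have := congr_fun (congr_fun h q) q
    simp [pivotTestD, grpOp, D.mem_grp_self h1] at this
  · rw [if_neg h1]
    refine ⟨fun h => absurd ?_ h, fun h => absurd h h1⟩
    by_cases h2 : D.slot q.1 = true
    · rw [if_pos h2]; rfl
    · rw [if_neg h2]; rfl

/-- The system's `o`-th test is the test at position `(flat n).symm o`. -/
theorem system_test_symm (o : Fin (n * n)) : D.system.test o = D.test ((flat n).symm o) := rfl

/-- **`#quadSupport = |P|`.** -/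
theorem card_quadSupport : D.system.quadSupport.card = Fintype.card {q // D.piv q = true} := by
  rw [← Fintype.card_coe]
  refine Fintype.card_congr (Equiv.subtypeEquiv (flat n).symm fun o => ?_)
  rw [AffSystem.quadSupport, Finset.mem_filter]
  simp only [Finset.mem_univ, true_and]
  exact D.test_M_ne_zero_iff _

/-- **M50 is attained**: `dim K(A,B) = #quadSupport` for every design at every base point
(`AffSystem.Correct.finrank_kerSpace_le` is the inequality `≤` for all correct affine systems). -/
theorem finrank_kerSpace_eq_card_quadSupport (A B : Vec n) :
    finrank ℂ (D.system.kerSpace A B) = D.system.quadSupport.card := by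
  rw [finrank_kerSpace_eq_card, card_quadSupport]

/-- The design's system is square: `m = n²` (M48's `n² ≤ m` attained). -/
theorem system_m : D.system.m = n * n := rfl

/-! ## Unmasking a design: exactly `|P|` generators -/

/-- The list of pivots. -/
def pivList : List (Fin n × Fin n) := D.pivots.toList

/-- `|pivList| = |P|`. -/
theorem length_pivList : D.pivList.length = Fintype.card {q // D.piv q = true} := by
  rw [pivList, Finset.length_toList, card_pivots]

/-- **Appending the generators at the pivots makes the design REDUCED AT EVERY base point.** -/
theorem reducedAt_unmask (A B : Vec n) : (D.system.appendCoord D.pivList).ReducedAt A B :=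
  AffSystem.reducedAt_appendCoord fun δ hδ hq => by
    rw [D.eq_sum_of_isKer hδ]
    exact Finset.sum_eq_zero fun q hq' => by
      rw [hq q (Finset.mem_toList.mpr hq'), zero_smul]

/-- … and keeps it correct: a correct cubic extension by `|P|` generators, reduced everywhere. -/
theorem unmask_correct : (D.system.appendCoord D.pivList).Correct :=
  D.system_correct.appendCoord _

/-- **`|P|` generators are necessary**: any list of appended generators making the design reduced at
some base point has length `≥ |P|`. -/
theorem card_piv_le_length_of_unmask {qs : List (Fin n × Fin n)} {A B : Vec n}
    (h : (D.system.appendCoord qs).ReducedAt A B) :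
    Fintype.card {q // D.piv q = true} ≤ qs.length := by
  rw [← D.finrank_kerSpace_eq_card A B]
  exact AffSystem.finrank_kerSpace_le_length_of_reducedAt h

/-- Summary: the generator-unmasking number of a design is EXACTLY `|P|`, at every base point. -/
theorem unmask_exact (A B : Vec n) :
    (∃ qs : List (Fin n × Fin n), qs.length = Fintype.card {q // D.piv q = true} ∧
        (D.system.appendCoord qs).Correct ∧ (D.system.appendCoord qs).ReducedAt A B) ∧
      ∀ qs : List (Fin n × Fin n), (D.system.appendCoord qs).ReducedAt A B →
        Fintype.card {q // D.piv q = true} ≤ qs.length :=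
  ⟨⟨D.pivList, D.length_pivList, D.unmask_correct, D.reducedAt_unmask A B⟩,
    fun _ h => D.card_piv_le_length_of_unmask h⟩

end PivotDesign

end Summit.MatrixMultiplication.MatrixMultiplication.Theorems.GraphEquations

end
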